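import Literature.NumberTheory.Automorphic.CDTTheorem722
import Literature.NumberTheory.Automorphic.HeckeAlgebraOfTypeSigma
import Literature.NumberTheory.EllipticCurves.ManinConstantQuadraticTwistClassCertificate
import Literature.NumberTheory.EllipticCurves.TateModuleContinuityProofs
import Literature.NumberTheory.EllipticCurves.TateModuleFreeProofs
import Literature.NumberTheory.EllipticCurves.FrobeniusTateModuleProofs
import Literature.NumberTheory.EllipticCurves.NeronOggShafarevich
import Literature.NumberTheory.GaloisRepresentations.FramedRepBaseChange
import Literature.NumberTheory.GaloisRepresentations.OrdinaryGaloisRep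
import Literature.NumberTheory.Automorphic.HilbertResidualModularity
import Literature.RingTheory.CompleteIntersection.CongruenceModule
import Mathlib.Algebra.Module.Torsion.Basic
import Mathlib.RingTheory.Length
import Mathlib.RingTheory.AdicCompletion.Basic
import Mathlib.RingTheory.DiscreteValuationRing.Basic
import Mathlib.RingTheory.Flat.Basic
import Mathlib.RingTheory.MvPowerSeries.Basic
import HarnessLib

/-!
# STUB-IDEAS k2 (RESHAPE) — typed helper statements for `stub_liftThree`, generation 4

Companion of `STUB-IDEAS-stub_liftThree-2.md` (g4). The g2 file `STUB_IDEAS_stub_liftThree_2.lean`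
(ns `…StubIdeas2`: regime split, Plan A/B/C, DRS Criterion II) and the g3 file
`STUB_IDEAS_stub_liftThree_2g3.lean` (ns `…StubIdeas2g3`: E3 = Brochard / de Smit one-level
freeness) stay valid and are NOT repeated; §0 restates verbatim only the Props this file's closers
consume. New here:

* §1 (Δ1) **regime II road** (`W` multiplicative at `3`, the Frey-relevant regime `3 ∣ abc`): the
  tree's `modularLiftsOfTypeSigma p k Ō ρ S` bakes in `¬ p ∣ M`, so no weight-2 Hecke set of level
  `3 ∥ M` exists in the tree; `modularLiftsSemistableAt` is the sibling definition (request D2′),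
  H8 is the Tate-curve dictionary lemma (`ρ_{W,3}|G₃` ordinary of weight 2), F_B1-ord / F_BΣ-ord are
  the named seats, and `liftThreeMult_of_planBord` is the PROVED closer into g2's `LiftThreeMult`.
* §2 (Δ2) **E4 = Diamond's module numerical criterion** (Invent. 128 (1997) Thm 2.4, in the
  Iyengar–Khare–Manning / Fakhruddin–Khare–Ramakrishna codimension-0 form, arXiv:2510.11875 Thm 5):
  the congruence module `Ψ_θ(M) = M ⧸ (M[𝔭] + M[A[𝔭]])` of a MODULE, the inequality
  `length Ψ_θ(M) ≤ μ · length (𝔭/𝔭²)`, and equality ⇒ `A` c.i. and `M ≅ A^μ ⊕ W` — typed over the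
  tree's `CongruenceModule` / `CotangentModule` / `congruenceIdeal` (the tree's
  `NumericalCriterion.lean` lists it under "Not here"). E5 is the PROVED `ℕ∞` arithmetic of the
  `Σ`-induction step (CDT 1999 §5.5), which together with E4 removes multiplicity one from the
  NON-minimal levels — needed in regime II, where `3` divides every level.

Every `sorry` is a proposed helper lemma (sizes in the .md); closers / glue are sorry-free.
`IsCompleteIntersectionOver'` mirrors the tree's `IsCompleteIntersectionOver` verbatim (module
`NumericalCriterion` is not built on the farm snapshot, as in g3).
-/

universe u v w

noncomputable section

open scoped MatrixGroups NumberField Polynomial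
open Field IsDedekindDomain Polynomial Rat.HeightOneSpectrum CongruenceSubgroup
open Literature.NumberTheory.GaloisRepresentations
open Literature.NumberTheory.EllipticCurves Literature.NumberTheory.EllipticCurves.ModularForms
open Literature.NumberTheory.Automorphic Literature.NumberTheory.Automorphic.BCDT
open Literature.RingTheory.CompleteIntersection
open WeierstrassCurve

namespace Summit.ABC.ABC.Cruxes.FreyModularity.StubIdeas2g4

/-! ## §0. Verbatim from g2 (`…StubIdeas2`): the stub, the regimes, the Tate frame, H7-as-Prop -/

/-- The registered signature of `stub_liftThree` (skeleton `Lines/Sketch.lean` :157), verbatim. -/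
def LiftThree : Prop :=
  ∀ (W : WeierstrassCurve ℚ) [W.IsElliptic] (ρ : ModPGaloisRep ℚ (ZMod 3) 2),
    W.IsTorsionGaloisRep 3 ρ → ρ.IsAbsIrreducibleOverSqrt (-3) → ¬ 9 ∣ W.conductorNorm ℤ →
      ρ.IsModular → W.IsModularGaloisRepTate 3

/-- Regime I (g2): good reduction at `3`. -/
def LiftThreeGood : Prop :=
  ∀ (W : WeierstrassCurve ℚ) [W.IsElliptic] (ρ : ModPGaloisRep ℚ (ZMod 3) 2),
    W.IsTorsionGaloisRep 3 ρ → ρ.IsAbsIrreducibleOverSqrt (-3) → W.HasGoodReductionAtPrime 3 →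
      ρ.IsModular → W.IsModularGaloisRepTate 3

/-- Regime II (g2): multiplicative reduction at `3`. -/
def LiftThreeMult : Prop :=
  ∀ (W : WeierstrassCurve ℚ) [W.IsElliptic] (ρ : ModPGaloisRep ℚ (ZMod 3) 2),
    W.IsTorsionGaloisRep 3 ρ → ρ.IsAbsIrreducibleOverSqrt (-3) →
      W.HasMultiplicativeReductionAtPrime 3 → ρ.IsModular → W.IsModularGaloisRepTate 3

/-- GLUE (g2, proved): the two regimes re-assemble the stub. -/
theorem liftThree_of_regimes (hI : LiftThreeGood) (hII : LiftThreeMult) : LiftThree := by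
  intro W _ ρ hρ hirr h9 hmod
  have h9' : ¬ 3 ^ 2 ∣ W.conductorNorm ℤ := by simpa using h9
  rcases hasGoodReductionAtPrime_or_hasMultiplicativeReductionAtPrime_of_not_sq_dvd_conductorNorm
      (V := W) h9' with hg | hm
  · exact hI W ρ hρ hirr hg hmod
  · exact hII W ρ hρ hirr hm hmod

section Frame

variable (W : WeierstrassCurve ℚ) [W.IsElliptic]
  [Module.Finite ℤ_[3] (W.tateModule 3)] [IsModuleTopology ℤ_[3] (W.tateModule 3)]

/-- H2 (g2): the integral 3-adic Tate frame `[T₃W]_b`. -/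
abbrev tateFrame (b : Module.Basis (Fin 2) ℤ_[3] (W.tateModule 3)) : FramedGaloisRep ℚ ℤ_[3] 2 :=
  (WeierstrassCurve.tateGaloisRep W 3 (W.continuous_galoisRepTate_holds 3)).frame b

end Frame

/-- H7 as a Prop (g2; level `M` may be divisible by `3`, so it serves regime II unchanged). -/
def NewformFrameGivesTate : Prop :=
  ∀ (W : WeierstrassCurve ℚ) [W.IsElliptic]
    [Module.Finite ℤ_[3] (W.tateModule 3)] [IsModuleTopology ℤ_[3] (W.tateModule 3)]
    (b : Module.Basis (Fin 2) ℤ_[3] (W.tateModule 3))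
    {Ō : Type} [CommRing Ō] [IsDomain Ō] [CharZero Ō] [TopologicalSpace Ō] [IsTopologicalRing Ō]
    [Algebra ℤ_[3] Ō] (hc : Continuous (algebraMap ℤ_[3] Ō))
    {M : ℕ} [NeZero M] (g : CuspForm (Gamma1 M) 2) (j : coeffCharIntegers g →+* Ō),
    IsNewform1 g →
      IsGaloisRepOfNewform1Int g j {r | r ∣ M * 3}
        (FramedRep.baseChange (algebraMap ℤ_[3] Ō) hc (tateFrame W b)) →
      W.IsModularGaloisRepTate 3

/-! ## §1 (Δ1). Regime II — the ordinary road through a level-`3 ∥ M` Hecke set -/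

section RegimeTwo

open IsLocalRing

variable (p : ℕ) (k : ℤ) {O : Type} [CommRing O] [TopologicalSpace O]
  (Ō : Type) [CommRing Ō] [IsLocalRing Ō] [TopologicalSpace Ō] [Algebra O Ō]
  (ρ : FramedGaloisRep ℚ O 2) (S : Set ℕ)

/-- D2′ (DEFINITION REQUEST, sibling of the tree's `modularLiftsOfTypeSigma`): the set
`N_Σ^{ss}(Ō)` of modular lifts of `ρ` of type `Σ` that are SEMISTABLE AT `p` in the sense of
Darmon–Diamond–Taylor §2.7 (p. 76: "`ρ|G_ℓ` is semi-stable" = good or ordinary) — the only change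
w.r.t. the tree definition is `¬ p ^ 2 ∣ M` in place of `¬ p ∣ M`: weight-`k` newforms of level
`M` with `p ∥ M` allowed (for `k = 2`, `p ∥ M` their `ρ_g|G_p` is ordinary by the tree's named
fact `darmonDiamondTaylor1995_ordinary_of_weightTwo_newform_dvd_level`; `p ∤ M` gives the flat
members).  DDT's extra clause "if `ℓ ∉ Σ` and `ρ̄|G_ℓ` good then `ρ|G_ℓ` good" is NOT encoded
(it needs a finite-flat predicate the tree lacks); for `ρ̄ = ρ̄_{W,3}` with `W` multiplicative at
`3` and `3 ∤ v₃(Δ)` it is vacuous, and in the peu-ramifié case `3 ∣ v₃(Δ)` the set below is DDT's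
`N_{Σ ∪ {3}}`. [cite: DarmonDiamondTaylor1995, §2.7 p. 76, §3.3 p. 94; Diamond1996, §1] -/
def modularLiftsSemistableAt : Set (FramedGaloisRep ℚ Ō 2) :=
  {ρ' | (∃ (M : ℕ) (_ : NeZero M) (g : CuspForm (Gamma1 M) k) (j : coeffCharIntegers g →+* Ō),
          IsNewform1 g ∧ ¬ p ^ 2 ∣ M ∧ IsGaloisRepOfNewform1Int g j {r | r ∣ M * p} ρ') ∧
      (∀ (σ : absoluteGaloisGroup ℚ) (i : ℕ),
          (FramedRep.charpoly ρ' σ).coeff i - algebraMap O Ō ((FramedRep.charpoly ρ σ).coeff i) ∈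
            maximalIdeal Ō) ∧
      (∀ σ : absoluteGaloisGroup ℚ,
          ((ρ' σ : GL (Fin 2) Ō) : Matrix (Fin 2) (Fin 2) Ō).det =
            algebraMap O Ō ((ρ σ : GL (Fin 2) O) : Matrix (Fin 2) (Fin 2) O).det) ∧
      ∀ v : HeightOneSpectrum (𝓞 ℚ), ((primesEquiv v : Nat.Primes) : ℕ) ∉ S →
        ((primesEquiv v : Nat.Primes) : ℕ) ≠ p → ρ'.IsMinimallyRamifiedAt v}

variable {p k Ō ρ S} in
/-- Membership in `N_Σ^{ss}`, unfolded. [folklore] -/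
theorem mem_modularLiftsSemistableAt_iff {ρ' : FramedGaloisRep ℚ Ō 2} :
    ρ' ∈ modularLiftsSemistableAt p k Ō ρ S ↔
      (∃ (M : ℕ) (_ : NeZero M) (g : CuspForm (Gamma1 M) k) (j : coeffCharIntegers g →+* Ō),
          IsNewform1 g ∧ ¬ p ^ 2 ∣ M ∧ IsGaloisRepOfNewform1Int g j {r | r ∣ M * p} ρ') ∧
        (∀ (σ : absoluteGaloisGroup ℚ) (i : ℕ),
            (FramedRep.charpoly ρ' σ).coeff i -
                algebraMap O Ō ((FramedRep.charpoly ρ σ).coeff i) ∈ maximalIdeal Ō) ∧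
        (∀ σ : absoluteGaloisGroup ℚ,
            ((ρ' σ : GL (Fin 2) Ō) : Matrix (Fin 2) (Fin 2) Ō).det =
              algebraMap O Ō ((ρ σ : GL (Fin 2) O) : Matrix (Fin 2) (Fin 2) O).det) ∧
        ∀ v : HeightOneSpectrum (𝓞 ℚ), ((primesEquiv v : Nat.Primes) : ℕ) ∉ S →
          ((primesEquiv v : Nat.Primes) : ℕ) ≠ p → ρ'.IsMinimallyRamifiedAt v :=
  Iff.rfl

/-- The tree's set is contained in the semistable-at-`p` one (`p ∤ M ⇒ p² ∤ M`): regime I's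
minimal lifts are regime-II-admissible, so ONE `Σ`-induction engine serves both. [folklore] -/
theorem modularLiftsOfTypeSigma_subset_semistableAt :
    modularLiftsOfTypeSigma p k Ō ρ S ⊆ modularLiftsSemistableAt p k Ō ρ S := by
  intro ρ' h
  obtain ⟨⟨M, hM, g, j, hg, hpM, hgal⟩, h2, h3, h4⟩ := (mem_modularLiftsOfTypeSigma_iff).mp h
  exact ⟨⟨M, hM, g, j, hg, fun h9 => hpM (dvd_trans (dvd_pow_self p two_ne_zero) h9), hgal⟩,
    h2, h3, h4⟩

end RegimeTwo

section RegimeTwoCurve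

variable (W : WeierstrassCurve ℚ) [W.IsElliptic]
  [Module.Finite ℤ_[3] (W.tateModule 3)] [IsModuleTopology ℤ_[3] (W.tateModule 3)]

/-- H8 (size M; the regime-II dictionary lemma): if `W` has multiplicative reduction at `3` then
`ρ_{W,3}|G_{ℚ₃}` is ORDINARY OF WEIGHT 2 with inertial exponent `1`: in a suitable `ℤ₃`-frame it is
`(χ₃ δ  ∗ ; 0  δ)` with `δ` the unramified (at most quadratic) character of the split/non-split
type — Tate's uniformisation `0 → T₃(μ) ⊗ δ → T₃(W) → ℤ₃(δ) → 0` over `ℚ₃` (the quotient is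
`ℤ₃`-torsion-free, so the line is saturated and a complementary basis vector exists over the DVR
`ℤ₃`, which is what `IsOrdinaryOfWeight` asks).  Tree patterns: `IsOrdinaryOfWeightAt`,
`isOrdinaryOfWeightAt_iff`, the `v ∤ p` analogue
`exists_tateBasis_localPoints_of_hasMultiplicativeReductionAt` (MultiplicativeInertiaLineProofs).
[cite: SilvermanATAEC1994, Thm V.5.3, Lemma V.5.2, Ex. 5.13; DarmonDiamondTaylor1995, Prop. 2.12 (c)
p. 59; Serre1972, §1.12] -/
theorem isOrdinaryOfWeightAt_tateFrame_of_hasMultiplicativeReductionAtPrime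
    (b : Module.Basis (Fin 2) ℤ_[3] (W.tateModule 3)) (hm : W.HasMultiplicativeReductionAtPrime 3)
    (v : HeightOneSpectrum (𝓞 ℚ)) (hv : ((primesEquiv v : Nat.Primes) : ℕ) = 3) :
    FramedGaloisRep.IsOrdinaryOfWeightAt 3 (tateFrame W b) v 2 1 := by
  sorry

end RegimeTwoCurve

/-- F_B1-ord (NAMED SEAT; Diamond 1996 Thm 5.1 "`ρ̄` modular ⇒ `Φ_∅ ≠ ∅`" in the ordinary-at-`ℓ`
case, `ℓ = 3`; inputs in print: Ribet/Carayol level optimisation, Diamond's refined Serre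
conjecture for the minimal weight-2 level `N(ρ̄)·3^{≤1}`, NO companion-form issue since the lift
sought is ordinary): for `W` multiplicative at `3` with `ρ̄_{W,3}` modular and absolutely
irreducible over `ℚ(√-3)`, a MINIMAL modular lift semistable at `3` exists over some `3`-adic `Ō`.
[cite: Diamond1996, Thm. 5.1; DarmonDiamondTaylor1995, Thm. 3.42 setting; CDT1999, Prop. 5.4.1] -/
def MinimalModularLiftThreeMult : Prop :=
  ∀ (W : WeierstrassCurve ℚ) [W.IsElliptic]
    [Module.Finite ℤ_[3] (W.tateModule 3)] [IsModuleTopology ℤ_[3] (W.tateModule 3)]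
    (b : Module.Basis (Fin 2) ℤ_[3] (W.tateModule 3)) (ρ : ModPGaloisRep ℚ (ZMod 3) 2),
    W.IsTorsionGaloisRep 3 ρ → W.HasMultiplicativeReductionAtPrime 3 →
      ρ.IsAbsIrreducibleOverSqrt (-3) → ρ.IsModular →
        ∃ (Ō : Type) (_ : CommRing Ō) (_ : IsLocalRing Ō) (_ : IsDomain Ō) (_ : CharZero Ō)
          (_ : TopologicalSpace Ō) (_ : IsTopologicalRing Ō) (_ : Algebra ℤ_[3] Ō),
          Continuous (algebraMap ℤ_[3] Ō) ∧
            (modularLiftsSemistableAt 3 2 Ō (tateFrame W b) ∅).Nonempty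

/-- F_BΣ-ord (NAMED SEAT = the regime-II `R_Σ = T_Σ` theorem SPECIALISED to the point `ρ_{W,3}`;
Diamond 1996 Thm 5.3 ordinary case / DDT Thm 3.42 with `ℓ = 3 ∈ Σ`): if `ρ̄_{W,3}` has a minimal
modular lift semistable at `3`, then `[T₃W]_b ⊗ Ō` lies in `N^{ss}_{Σ_W}`, `Σ_W = {p ∣ N_W}`.
Hidden inside: `ρ_{W,3}` is such a lift (ordinary at `3` by H8, `det = χ₃` by g2's H4, minimally
ramified off `Σ_W` by g2's H6); minimal `R^{ord}_∅ ≅ T^{ord}_∅` (E3 of g3 at one TW level, the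
`D₃`-distinguishedness `ω|D₃ ≠ 1` being automatic); induction on `Σ` by E4 + E5 below WITHOUT
multiplicity one at the `3`-new levels. [cite: Diamond1996, Thm. 5.3; DarmonDiamondTaylor1995,
Thm. 3.42; Diamond1997, Thm. 2.4; CDT1999, §5.5] -/
def TypeSigmaLiftThreeMult : Prop :=
  ∀ (W : WeierstrassCurve ℚ) [W.IsElliptic]
    [Module.Finite ℤ_[3] (W.tateModule 3)] [IsModuleTopology ℤ_[3] (W.tateModule 3)]
    (b : Module.Basis (Fin 2) ℤ_[3] (W.tateModule 3))
    {Ō : Type} [CommRing Ō] [IsLocalRing Ō] [IsDomain Ō] [CharZero Ō] [TopologicalSpace Ō]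
    [IsTopologicalRing Ō] [Algebra ℤ_[3] Ō] (hc : Continuous (algebraMap ℤ_[3] Ō)),
    W.HasMultiplicativeReductionAtPrime 3 →
      (modularLiftsSemistableAt 3 2 Ō (tateFrame W b) ∅).Nonempty →
        FramedRep.baseChange (algebraMap ℤ_[3] Ō) hc (tateFrame W b) ∈
          modularLiftsSemistableAt 3 2 Ō (tateFrame W b) {p | p ∣ W.conductorNorm ℤ}

/-- Regime II closer (PROVED): F_B1-ord → F_BΣ-ord → H7 → `LiftThreeMult`; with g2's
`liftThreeGood_of_planB` and `liftThree_of_regimes` this reaches the stub. -/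
theorem liftThreeMult_of_planBord (hB1 : MinimalModularLiftThreeMult) (hBS : TypeSigmaLiftThreeMult)
    (h7 : NewformFrameGivesTate) : LiftThreeMult := by
  intro W _ ρ hρ hirr hm hmod
  haveI : Module.Finite ℤ_[3] (W.tateModule 3) := module_finite_tateModule_holds W 3
  haveI : IsModuleTopology ℤ_[3] (W.tateModule 3) :=
    TateModule.isModuleTopology (A := geomPoints W) (p := 3)
  haveI : Module.Free ℤ_[3] (W.tateModule 3) := module_free_tateModule_holds W 3
  have hrank : Module.finrank ℤ_[3] (W.tateModule 3) = 2 :=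
    finrank_tateModule_eq_two_holds W 3 (by norm_num)
  obtain ⟨b⟩ : Nonempty (Module.Basis (Fin 2) ℤ_[3] (W.tateModule 3)) :=
    ⟨Module.finBasisOfFinrankEq ℤ_[3] (W.tateModule 3) hrank⟩
  obtain ⟨Ō, _, _, _, _, _, _, _, hc, hne⟩ := hB1 W b ρ hρ hm hirr hmod
  have hmem := hBS W b hc hm hne
  obtain ⟨⟨M, hM, g, j, hg1, -, hgal⟩, -, -, -⟩ := (mem_modularLiftsSemistableAt_iff).mp hmem
  exact h7 W b hc g j hg1 hgal

/-- The whole stub from the two Plan-B roads (PROVED glue; regime I inputs are g2's Props, taken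
here as the single hypothesis `LiftThreeGood`). -/
theorem liftThree_of_planB_both (hI : LiftThreeGood) (hB1 : MinimalModularLiftThreeMult)
    (hBS : TypeSigmaLiftThreeMult) (h7 : NewformFrameGivesTate) : LiftThree :=
  liftThree_of_regimes hI (liftThreeMult_of_planBord hB1 hBS h7)

/-! ## §2 (Δ2). E4 — Diamond's numerical criterion for MODULES, and the `Σ`-step arithmetic E5 -/

section ModuleCriterion

open IsLocalRing

/-- Local mirror of the tree's `Literature.RingTheory.CompleteIntersection.IsCompleteIntersectionOver`
(same body; that module is not built on the farm snapshot). -/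
def IsCompleteIntersectionOver' (O : Type u) (T : Type v) [CommRing O] [CommRing T]
    [Algebra O T] : Prop :=
  ∃ (n : ℕ) (f : Fin n → MvPowerSeries (Fin n) O),
    Nonempty ((MvPowerSeries (Fin n) O ⧸ Ideal.span (Set.range f)) ≃ₐ[O] T)

variable {O : Type u} [CommRing O] {A : Type v} [CommRing A] [Algebra O A] (θ : A →ₐ[O] O)
variable (M : Type w) [AddCommGroup M] [Module A M] [Module O M] [IsScalarTower O A M]

/-- `M[𝔭]`, `𝔭 = ker θ`: the elements of `M` killed by `𝔭`. -/
abbrev torsionKer : Submodule A M :=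
  Submodule.torsionBySet A M ((RingHom.ker θ : Ideal A) : Set A)

/-- `M[I]`, `I = A[𝔭] = Ann_A(𝔭)`: the elements of `M` killed by `I`. -/
abbrev torsionAnn : Submodule A M :=
  Submodule.torsionBySet A M (((RingHom.ker θ).annihilator : Ideal A) : Set A)

/-- **Congruence module of a module** `Ψ_θ(M) = M ⧸ (M[𝔭] + M[I])` (Diamond 1997 `Ω`; CDT 1999
§5.5 `C_{S,θ} = L_S/(L_S[𝔭_S] + L_S[J_S])`; Iyengar–Khare–Manning `Ψ_λ(M)`), as an `O`-module.
[cite: Diamond1997, §2; CDT1999, §5.5 p. 543; Iyengar2025survey = arXiv:2510.11875, §3 eq. (cmod)] -/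
abbrev ModuleCongruenceModule : Type w :=
  M ⧸ (torsionKer θ M ⊔ torsionAnn θ M)

/-- E4-0 (size S; sanity / base of E4f): for `M = A` finite and torsion-free over a domain `O` with
`η_θ ≠ 0`, `A[𝔭] = Ann(𝔭)` and `A[Ann 𝔭] = 𝔭` (write `t = (t - θ t) + θ t`, use `𝔭 · Ann 𝔭 = 0`
and torsion-freeness), so `Ψ_θ(A)` is Hida's `A ⧸ (𝔭 ⊔ Ann 𝔭) ≅ O ⧸ η` = the tree's
`CongruenceModule θ` (`quotientKerSupAnnihilatorEquiv`). [cite: Hida2000, §5.3.3 p. 276] -/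
theorem nonempty_moduleCongruenceModule_self_equiv [IsDomain O] [Module.IsTorsionFree O A]
    (hη : congruenceIdeal θ ≠ ⊥) :
    Nonempty (ModuleCongruenceModule θ A ≃ₗ[O] CongruenceModule θ) := by
  sorry

/-- E4f (size S given E4-0; DDT Lemma 4.17, equality case "if `L` is free"): `Ψ_θ` commutes with
finite direct sums, so for `M` free of rank `μ` over `A`,
`length_O Ψ_θ(M) = μ · length_O (O ⧸ η_θ)`. [cite: DarmonDiamondTaylor1995, Lemma 4.17 p. 126] -/
theorem length_moduleCongruenceModule_of_free [IsDomain O] [Module.IsTorsionFree O A]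
    (hη : congruenceIdeal θ ≠ ⊥) [Module.Free A M] [Module.Finite A M] (μ : ℕ)
    (hμ : Module.finrank A M = μ) :
    Module.length O (ModuleCongruenceModule θ M) = μ * Module.length O (CongruenceModule θ) := by
  sorry

/-- E4≤ (size M; "Criterion I for modules", arXiv:2510.11875 Thm 5 first half, essentially Diamond
1997 / Wiles): `O` a complete DVR, `A` a local quotient of some `O[[X₁,…,Xₙ]]`, `θ : A → O` with
FINITE cotangent module `𝔭/𝔭²` (⟺ `θ` is a regular `O`-point of codimension `0`), `M` finite over
`A` and finite free over `O` (so `depth_A M ≥ 1`: the uniformiser is `M`-regular), `μ = rank_O M[𝔭]`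
(= the rank of `M` at `𝔭`). Then `length_O Ψ_θ(M) ≤ μ · length_O (𝔭/𝔭²)`.
Engine: Fitting ideals, `Fitt₀(𝔭) ⊆ A[𝔭]`, applied to a presentation of `M` — tree assets
`Literature.RingTheory.FittingIdeal.*`, `…Koszul.TopKoszulHomology` (`H_n(x; M) ≃ M[(x)]`).
[cite: Iyengar2025survey, Thm. 5; Diamond1997, Thm. 2.4; FakhruddinKhareRamakrishna2021, App.] -/
theorem length_moduleCongruenceModule_le [IsDomain O] [IsDiscreteValuationRing O]
    [IsAdicComplete (maximalIdeal O) O] [IsLocalRing A] [IsNoetherianRing A]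
    (hA : ∃ (n : ℕ) (f : MvPowerSeries (Fin n) O →ₐ[O] A), Function.Surjective f)
    (hreg : Module.length O (CotangentModule θ) ≠ ⊤)
    [Module.Finite A M] [Module.Finite O M] [Module.Free O M] (μ : ℕ)
    (hμ : Module.finrank O ↥(torsionKer θ M) = μ) :
    Module.length O (ModuleCongruenceModule θ M) ≤ μ * Module.length O (CotangentModule θ) := by
  sorry

/-- E4= (size L; Diamond's theorem proper, arXiv:2510.11875 Thm 5 second half): in the setting of
E4≤ with `M` supported at `𝔭` (`μ ≥ 1`), EQUALITY `length_O Ψ_θ(M) = μ · length_O(𝔭/𝔭²)` holds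
iff `A` is a complete intersection over `O` and `M ≅ A^μ ⊕ W` with `W` not supported at `𝔭`; typed
here is the direction the `Σ`-induction uses (⇒). Proof routes: (i) the survey's — the case `M = A`
is Wiebe's criterion `∧^e H₁(K) ≠ 0 ⇒ Artinian c.i.` (SAME lemma as g3's E3a4 `wiebe_core`, now
readable through the tree's Koszul library) plus a splitting argument for `M`; (ii) Diamond's
original three pages (Invent. 128 §2). [cite: Iyengar2025survey, Thm. 5–7; Diamond1997, Thm. 2.4;
BrunsHerzog1998, Thm. 2.3.16 (Wiebe)] -/
theorem exists_free_summand_of_length_eq [IsDomain O] [IsDiscreteValuationRing O]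
    [IsAdicComplete (maximalIdeal O) O] [IsLocalRing A] [IsNoetherianRing A]
    (hA : ∃ (n : ℕ) (f : MvPowerSeries (Fin n) O →ₐ[O] A), Function.Surjective f)
    (hreg : Module.length O (CotangentModule θ) ≠ ⊤)
    [Module.Finite A M] [Module.Finite O M] [Module.Free O M] (μ : ℕ) (hμ0 : 0 < μ)
    (hμ : Module.finrank O ↥(torsionKer θ M) = μ)
    (heq : Module.length O (ModuleCongruenceModule θ M) = μ * Module.length O (CotangentModule θ)) :
    IsCompleteIntersectionOver' O A ∧
      ∃ (W : Type w) (_ : AddCommGroup W) (_ : Module A W),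
        Nonempty (M ≃ₗ[A] ((Fin μ → A) × W)) ∧ ∀ x : W, ∃ a ∉ RingHom.ker θ, a • x = 0 := by
  sorry

/-- E4c (size S; kills the complement by an `O`-rank count): in E4='s conclusion, if moreover `A`
is finite free over `O` and `rank_O M = μ · rank_O A` (CDT: `L_S ⊗ K` free of rank 2 over
`T_S ⊗ K`), then `W = 0` and `M` is free of rank `μ` over `A` (`O` a PID, e.g. a DVR: the
summand `W` is `O`-free of rank `rank_O M − μ·rank_O A = 0`). [folklore] -/
theorem free_of_free_summand_of_finrank_eq [IsDomain O] [IsPrincipalIdealRing O]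
    [Module.Finite O A] [Module.Free O A]
    [Module.Finite O M] [Module.Free O M] (μ : ℕ)
    (hrk : Module.finrank O M = μ * Module.finrank O A)
    (hW : ∃ (W : Type w) (_ : AddCommGroup W) (_ : Module A W),
        Nonempty (M ≃ₗ[A] ((Fin μ → A) × W)) ∧ ∀ x : W, ∃ a ∉ RingHom.ker θ, a • x = 0) :
    Module.Free A M := by
  sorry

/-- **E4d = Diamond 1997 Theorem 2.4 in the printed `R ↠ T ⊆ End_O(H)` form** (size M GIVEN E4≤,
E4=, E4c, g3's E3d and the tree's PROVED Criterion I `bijective_of_length_cotangentModule_le`; the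
form CDT 1999 §5.5 invokes): `O` complete DVR, `R` complete local Noetherian `O`-algebra,
`φ : R ↠ T`, `T` local finite free over `O` acting faithfully on `H` finite free over `O`,
`θ : T → O` with `η_θ ≠ 0`, `μ = rank_O H[𝔭_T] ≥ 1`, `rank_O H = μ · rank_O T`, `Ψ_θ(H)` finite.
If `μ · length_O Φ_R ≤ length_O Ψ_θ(H)` (`Φ_R = I_R/I_R²`, `I_R = ker (θ ∘ φ)`) then `φ` is an
isomorphism, `T` is a complete intersection over `O`, and `H` is free over `T`.
Glue: `length Ψ_T(H) ≤ μ·length Φ_T ≤ μ·length Φ_R ≤ length Ψ_T(H)` (E4≤, `mapCotangent_surjective`)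
⇒ equalities ⇒ (E4=, E4c) `T` c.i., `H` free ⇒ (E3d) `length Φ_T = length O/η_T = length Φ_R` ⇒
(Criterion I) `φ` bijective. [cite: Diamond1997, Thm. 2.4; CDT1999, §5.5 p. 543] -/
theorem diamond_theorem_2_4 [IsDomain O] [IsDiscreteValuationRing O]
    [IsAdicComplete (maximalIdeal O) O]
    {R : Type v} [CommRing R] [IsLocalRing R] [IsNoetherianRing R]
    [IsAdicComplete (maximalIdeal R) R] [Algebra O R]
    {T : Type v} [CommRing T] [IsLocalRing T] [Algebra O T] [Module.Finite O T] [Module.Free O T]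
    (φ : R →ₐ[O] T) (θ : T →ₐ[O] O) (hφ : Function.Surjective φ) (hη : congruenceIdeal θ ≠ ⊥)
    {H : Type w} [AddCommGroup H] [Module T H] [Module O H] [IsScalarTower O T H]
    [Module.Finite O H] [Module.Free O H]
    (hfaith : ∀ t : T, (∀ h : H, t • h = 0) → t = 0)
    (μ : ℕ) (hμ0 : 0 < μ) (hμ : Module.finrank O ↥(torsionKer θ H) = μ)
    (hrk : Module.finrank O H = μ * Module.finrank O T)
    (hfin : Module.length O (ModuleCongruenceModule θ H) ≠ ⊤)
    (hcrit : μ * Module.length O (CotangentModule (θ.comp φ)) ≤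
      Module.length O (ModuleCongruenceModule θ H)) :
    Function.Bijective φ ∧ IsCompleteIntersectionOver' O T ∧ Module.Free T H := by
  sorry

end ModuleCriterion

/-- **E5 — the `Σ`-induction step is `ℕ∞` arithmetic** (PROVED; CDT 1999 §5.5 p. 543 "we can combine
this with Theorem 2.4 of [Diamond 1997] and Corollary 1.4.3"): with `μ = 2`,
`a' = length Φ_{R_{S'}}`, `e = length O/η_S = length Φ_{R_S}` (level `S` known: iso of c.i.),
`m = length O/θ(μ_p)`, `c = length C_{S,θ}`, `c' = length C_{S',θ}`:
Selmer growth `a' ≤ e + m` (CDT Cor 1.4.3 / DDT Cor 3.37 shape) + freeness at level `S`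
`c = μ e` (E4f) + Ihara `c' = c + μ m` (CDT Prop 5.5.1) ⟹ the E4d hypothesis `μ a' ≤ c'` at
level `S'`. [cite: CDT1999, §5.5; DarmonDiamondTaylor1995, (3.5.2)] -/
theorem sigma_step_criterion {a' e m c c' : ℕ∞} (μ : ℕ∞) (hSel : a' ≤ e + m) (hC : c = μ * e)
    (hIh : c' = c + μ * m) : μ * a' ≤ c' := by
  calc μ * a' ≤ μ * (e + m) := mul_le_mul_left' hSel μ
    _ = μ * e + μ * m := mul_add μ e m
    _ = c' := by rw [hIh, hC]

/-- Degenerate-witness check for E5 (`μ = 0`: vacuous level, everything `0`). -/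
example : (0 : ℕ∞) * 7 ≤ 0 := by simp

end Summit.ABC.ABC.Cruxes.FreyModularity.StubIdeas2g4

end
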